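import Mathlib.MeasureTheory.Measure.Hausdorff
import Mathlib.Topology.MetricSpace.Bounded

/-!
# Finite ball covers of compact sets of small Hausdorff measure

If a compact set `K` in a metric space has `𝓗ᵈ(K) < γ`, then for every `s₀ > 0` it is covered by
**finitely many** open balls of radii `≤ s₀` with `Σ ρᵢᵈ ≤ 2ᵈ⁺¹ · 2γ`
(`exists_finset_ball_cover_of_hausdorffMeasure_lt`): by the definition of the Hausdorff measure
(`MeasureTheory.Measure.hausdorffMeasure_apply`) there is a countable cover by sets of small diameter
with `Σ diamᵈ < γ`; enlarge each to a ball and extract a finite subcover. (The Hausdorff content is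
dominated by the Hausdorff measure, [Federer1969, 2.10.2].) Used to bound the mass of blow-ups of a
holomorphic chain near small exceptional sets via upper density bounds (King's tangent cone theorem).

Theorems only; no named facts.

## References

* H. Federer, *Geometric Measure Theory*, Springer 1969, 2.10.2 [Federer1969].
-/

noncomputable section

open scoped ENNReal NNReal Topology
open MeasureTheory Set Filter Metric EMetric

namespace Literature.Geometry.GeometricMeasureTheory

variable {X : Type*} [MetricSpace X] [MeasurableSpace X] [BorelSpace X]

/-- **Finite ball covers of compact sets of small Hausdorff measure.** If `K` is compact with
`μH[d] K < γ` (`d ≥ 0`) and `s₀ > 0`, there are finitely many balls `ball (x n) (ρ n)`, `n ∈ S`,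
with `0 < ρ n ≤ s₀`, covering `K`, and `Σ_{n ∈ S} ρ(n)ᵈ ≤ 2ᵈ⁺¹ (2γ)` (in `ℝ≥0∞`, radii via
`ENNReal.ofReal`). [cite: Federer1969, 2.10.2] -/
theorem exists_finset_ball_cover_of_hausdorffMeasure_lt [Nonempty X] {d : ℝ} (hd : 0 < d) {K : Set X}
    (hK : IsCompact K) {γ : ℝ≥0∞} (hγ : μH[d] K < γ) (hγtop : γ ≠ ⊤) {s₀ : ℝ} (hs₀ : 0 < s₀) :
    ∃ (S : Finset ℕ) (x : ℕ → X) (ρ : ℕ → ℝ), (∀ n ∈ S, 0 < ρ n ∧ ρ n ≤ s₀) ∧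
      K ⊆ ⋃ n ∈ S, ball (x n) (ρ n) ∧
      ∑ n ∈ S, ENNReal.ofReal (ρ n) ^ d ≤ 2 ^ (d + 1) * (2 * γ) := by
  classical
  have hγ0 : 0 < γ := lt_of_le_of_lt bot_le hγ
  rcases K.eq_empty_or_nonempty with rfl | hKne
  · exact ⟨∅, fun _ => Classical.arbitrary X, fun _ => s₀, by simp, by simp, by simp⟩
  -- a countable cover by sets of diameter `≤ r` with `Σ diamᵈ < γ`
  set r : ℝ≥0∞ := ENNReal.ofReal (s₀ / 2) with hr
  have hr0 : 0 < r := by rw [hr, ENNReal.ofReal_pos]; positivity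
  rw [Measure.hausdorffMeasure_apply] at hγ
  have h1 : (⨅ (t : ℕ → Set X) (_ : K ⊆ ⋃ n, t n) (_ : ∀ n, ediam (t n) ≤ r),
      ∑' n, ⨆ _ : (t n).Nonempty, ediam (t n) ^ d) < γ :=
    lt_of_le_of_lt (le_iSup₂ (f := fun (r : ℝ≥0∞) (_ : 0 < r) => ⨅ (t : ℕ → Set X)
      (_ : K ⊆ ⋃ n, t n) (_ : ∀ n, ediam (t n) ≤ r), ∑' n, ⨆ _ : (t n).Nonempty, ediam (t n) ^ d)
      r hr0) hγ
  obtain ⟨t, ht⟩ := iInf_lt_iff.1 h1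
  obtain ⟨htK, ht⟩ := iInf_lt_iff.1 ht
  obtain ⟨htr, hsum⟩ := iInf_lt_iff.1 ht
  -- centres and radii
  obtain ⟨x₀, hx₀⟩ := hKne
  have hxn : ∀ n, ∃ y : X, (t n).Nonempty → y ∈ t n := fun n => by
    by_cases h : (t n).Nonempty
    · exact ⟨h.some, fun _ => h.some_mem⟩
    · exact ⟨x₀, fun h' => absurd h' h⟩
  choose x hx using hxn
  -- slack `εₙ` with `Σ εₙᵈ ≤ γ`: εₙ := (γ' 2^{-(n+1)})^{1/d}` where `γ' = γ.toReal`
  set γ' : ℝ := γ.toReal with hγ'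
  have hγ'0 : 0 < γ' := ENNReal.toReal_pos hγ0.ne' hγtop
  set ε : ℕ → ℝ := fun n => min (s₀ / 2) ((γ' * (1 / 2) ^ (n + 1)) ^ (1 / d)) with hε
  have hε0 : ∀ n, 0 < ε n := fun n => lt_min (by positivity) (by positivity)
  have hεd : ∀ n, ENNReal.ofReal (ε n) ^ d ≤ ENNReal.ofReal (γ' * (1 / 2) ^ (n + 1)) := by
    intro n
    rw [ENNReal.ofReal_rpow_of_pos (hε0 n)]
    refine ENNReal.ofReal_le_ofReal ?_
    calc ε n ^ d ≤ ((γ' * (1 / 2) ^ (n + 1)) ^ (1 / d)) ^ d :=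
          Real.rpow_le_rpow (hε0 n).le (min_le_right _ _) hd.le
      _ = γ' * (1 / 2) ^ (n + 1) := by
          rw [← Real.rpow_mul (by positivity), one_div_mul_cancel hd.ne', Real.rpow_one]
  set ρ : ℕ → ℝ := fun n => (ediam (t n)).toReal + ε n with hρ
  have hdiam_top : ∀ n, ediam (t n) ≠ ⊤ := fun n =>
    ne_top_of_le_ne_top (by rw [hr]; exact ENNReal.ofReal_ne_top) (htr n)
  have hρ0 : ∀ n, 0 < ρ n := fun n => add_pos_of_nonneg_of_pos ENNReal.toReal_nonneg (hε0 n)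
  have hρs₀ : ∀ n, ρ n ≤ s₀ := by
    intro n
    have h1 : (ediam (t n)).toReal ≤ s₀ / 2 := by
      have := ENNReal.toReal_mono ENNReal.ofReal_ne_top (htr n)
      rwa [ENNReal.toReal_ofReal (by positivity)] at this
    have h2 : ε n ≤ s₀ / 2 := min_le_left _ _
    simp only [hρ]; linarith
  -- the balls cover `K`
  have hcover : K ⊆ ⋃ n, ball (x n) (ρ n) := by
    intro y hy
    obtain ⟨n, hn⟩ := mem_iUnion.1 (htK hy)
    refine mem_iUnion.2 ⟨n, ?_⟩
    have hne : (t n).Nonempty := ⟨y, hn⟩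
    rw [Metric.mem_ball]
    calc dist y (x n) ≤ (ediam (t n)).toReal := by
          rw [dist_edist]
          exact ENNReal.toReal_mono (hdiam_top n) (Metric.edist_le_ediam_of_mem hn (hx n hne))
      _ < ρ n := by simp only [hρ]; linarith [hε0 n]
  -- a finite subcover
  obtain ⟨S, hS⟩ := hK.elim_finite_subcover (fun n => ball (x n) (ρ n)) (fun n => isOpen_ball) hcover
  refine ⟨S, x, ρ, fun n _ => ⟨hρ0 n, hρs₀ n⟩, hS, ?_⟩
  -- the sum estimate: `ρₙᵈ ≤ 2ᵈ (diamₙᵈ + εₙᵈ)`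
  have hterm : ∀ n, ENNReal.ofReal (ρ n) ^ d ≤
      2 ^ d * ((⨆ _ : (t n).Nonempty, ediam (t n) ^ d) + ENNReal.ofReal (γ' * (1 / 2) ^ (n + 1))) := by
    intro n
    have hmax : ENNReal.ofReal (ρ n) ≤ 2 * max (ediam (t n)) (ENNReal.ofReal (ε n)) := by
      rw [hρ, ENNReal.ofReal_add ENNReal.toReal_nonneg (hε0 n).le,
        ENNReal.ofReal_toReal (hdiam_top n), two_mul]
      exact add_le_add (le_max_left _ _) (le_max_right _ _)
    calc ENNReal.ofReal (ρ n) ^ d ≤ (2 * max (ediam (t n)) (ENNReal.ofReal (ε n))) ^ d :=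
          ENNReal.rpow_le_rpow hmax hd.le
      _ = 2 ^ d * (max (ediam (t n)) (ENNReal.ofReal (ε n))) ^ d := by
          rw [ENNReal.mul_rpow_of_nonneg _ _ hd.le]
      _ ≤ 2 ^ d * ((⨆ _ : (t n).Nonempty, ediam (t n) ^ d) +
            ENNReal.ofReal (γ' * (1 / 2) ^ (n + 1))) := by
          gcongr
          rcases le_total (ediam (t n)) (ENNReal.ofReal (ε n)) with h | h
          · rw [max_eq_right h]
            exact (hεd n).trans le_add_self
          · rw [max_eq_left h]
            rcases (t n).eq_empty_or_nonempty with he | hne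
            · simp [he, hd]
            · exact le_add_right (le_iSup (fun _ : (t n).Nonempty => ediam (t n) ^ d) hne)
  have hgeom : ∑' n : ℕ, ENNReal.ofReal (γ' * (1 / 2) ^ (n + 1)) = γ := by
    have h1 : ∀ n : ℕ, ENNReal.ofReal (γ' * (1 / 2) ^ (n + 1)) =
        ENNReal.ofReal γ' * ((2⁻¹ : ℝ≥0∞) ^ (n + 1)) := by
      intro n
      rw [ENNReal.ofReal_mul hγ'0.le, ENNReal.ofReal_pow (by norm_num), one_div,
        ENNReal.ofReal_inv_of_pos two_pos, ENNReal.ofReal_ofNat]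
    simp_rw [h1, ENNReal.tsum_mul_left, pow_succ, ENNReal.tsum_mul_right, ENNReal.tsum_geometric,
      ENNReal.one_sub_inv_two, inv_inv]
    rw [ENNReal.mul_inv_cancel (by norm_num) (by norm_num), mul_one, hγ', ENNReal.ofReal_toReal hγtop]
  calc ∑ n ∈ S, ENNReal.ofReal (ρ n) ^ d
      ≤ ∑ n ∈ S, 2 ^ d * ((⨆ _ : (t n).Nonempty, ediam (t n) ^ d) +
          ENNReal.ofReal (γ' * (1 / 2) ^ (n + 1))) := Finset.sum_le_sum fun n _ => hterm n
    _ ≤ ∑' n, 2 ^ d * ((⨆ _ : (t n).Nonempty, ediam (t n) ^ d) +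
          ENNReal.ofReal (γ' * (1 / 2) ^ (n + 1))) := ENNReal.sum_le_tsum S
    _ = 2 ^ d * ((∑' n, ⨆ _ : (t n).Nonempty, ediam (t n) ^ d) +
          ∑' n, ENNReal.ofReal (γ' * (1 / 2) ^ (n + 1))) := by
        rw [ENNReal.tsum_mul_left, ENNReal.tsum_add]
    _ ≤ 2 ^ d * (γ + γ) := by
        rw [hgeom]
        gcongr
    _ ≤ 2 ^ (d + 1) * (2 * γ) := by
        rw [two_mul]
        gcongr
        · exact (by norm_num : (1 : ℝ≥0∞) ≤ 2)
        · linarith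

end Literature.Geometry.GeometricMeasureTheory
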